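import Summits.BirchSwinnertonDyer.Rank1Residual.X5.TwoAdicTargetsMultAuto
import Summits.BirchSwinnertonDyer.Rank1Residual.X5.TwoAdicTargetsSplitAuto
import Summits.BirchSwinnertonDyer.Rank1Residual.X2.AnalyticInvariants
import HarnessLib

/-!
# Class O1 (X5, `p = 2`, non-CM): the λ/μ-PINCH at a NON-SPLIT multiplicative `2` — from K11a,
# `μ = 0`, `λ(X) = n` and two finite certificates to `char_Λ X = (L₀)`; from that equality to
# `BSD(E,2)` in BOTH halves and to the rank-`0` `2`-converse; and the twist ANCHOR lemmas
# (`λ(X(E₀/ℚ_∞)) = 0` from Kato's `⊗ℚ` divisibility and one certificate, both signs)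

HONEST FRAMING (cell `bsd-2adic`, run/shared/lean/pub/bsd-2adic/, FULL-BSD rank ≤ 1 programme
tranche 1b, D-0036; seat `bsd-2adic-mult`, GEN 2): research routes; no claim beyond the stated
classes; nothing here is booked; no mark of RESIDUAL-MAP §I moves. THEOREMS ONLY (0 defs, 0 named
facts, 0 `@[conjecture]`). Consumed by the twist-anchor door (34-TW-mult) of
`X5/TwoAdicTargetsMultTwist.lean` (Matsuno 2008 Thm. 5.1 at a multiplicative `2`); split twin:
`X5/TwoAdicTargetsMultPinchSplit.lean`. Memo of record: `HOME/mult/PROOF-TWIST.md`.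

Currency: `Λ = IwasawaAlgebra 2`, `ι = iwasawaToPowerSeries 2`, `μ/λ = X1.MuLambda.mu/lam`;
`X2.AnalyticMuLE` / `X2.AnalyticLambdaEq` = the FINITE certificates on THE Mazur–Tate–Teitelbaum `2`-adic
`L`-function at a multiplicative `2`, Néron-normalised (`ϖ·L`, `ϖ·Ω_E = Ω⁺_f`), trivial zero included.
* `charIdeal_eq_span_of_lambda_mu_pinch_nonsplit` (PROVED, `Λ`-algebra on top of K11a): `X` torsion,
  `μ(X) = 0`, `λ(X) = n`; the K11a datum `ι g = 2ᵐ·L`, `g ∈ char X` (the seat's PROOF-MULT Thm. A,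
  referee PASS RC-2); `ι L₀ = ϖ·L`; certificates `λ(ϖ·L) = n`, `μ(ϖ·L) = 0` ⇒ `char_Λ X = (L₀)`
  (Greenberg–Vatsal p. 4: equal `μ` and `λ` upgrade a divisibility to an equality).
* `missingPPartAt_two_nonsplit_of_charIdeal_eq_span` (PROVED): that equality + Greenberg's non-split
  display A235 (`hEC`, `l_v = 2`) ⇒ `MissingPPartAt W 2` (`ord₂ #Ш_an = ord₂ #Ш`, BOTH halves).
* `entireLFunction_one_ne_zero_of_finite_selmer_of_charIdeal_eq_span_nonsplit` (PROVED): the rank-`0`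
  `2`-CONVERSE from the same equality (`Sel_{2^∞}(E/ℚ)` finite ⇒ `L₀(0) ≠ 0` ⇒ `L(E,1) ≠ 0`).
* `anchor_lambda_eq_zero_nonsplit` / `_split` (PROVED): for an anchor `E₀ = A` multiplicative at `2`
  with `μ(X(E₀/ℚ_∞)) = 0`, K11a / K11b-Rat at `A`, `hper₀`, and the certificates `λ(ϖ₀·L₂(E₀)) = δ_A`
  (`δ_A = 0` non-split, `1` split: the MINIMAL analytic `λ`) and `μ_an(E₀) ≤ m₀` for some `m₀`:
  `λ(X(E₀/ℚ_∞)) = 0`. No `BSD₂(E₀)`, no `2`-descent, no rank input at the anchor.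
NO `hlow`, NO `MultLowerDivisibilityAtTwoRat`, NO image hypothesis, NO slack anywhere in this file.

References: [GreenbergLNM1716] §4; [GreenbergVatsal2000] p. 4; [MazurTateTeitelbaum1986Invent] §I; [Miller2011LMS] 1.1.
-/

set_option autoImplicit false

noncomputable section
open scoped Classical MatrixGroups ModularForm

open CongruenceSubgroup WeierstrassCurve Literature.NumberTheory.EllipticCurves
  Literature.NumberTheory.EllipticCurves.ModularForms
  Literature.NumberTheory.EllipticCurves.Wuthrich2014
  Literature.NumberTheory.EllipticCurves.Rank1Residual
  Literature.NumberTheory.EllipticCurves.Rank1Residual.Typed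
  Literature.NumberTheory.EllipticCurves.Greenberg1999
  Summit.BirchSwinnertonDyer.Rank1Residual.X1.MuLambda
  Summit.BirchSwinnertonDyer.Rank1Residual.X1.MuPart
  Summit.BirchSwinnertonDyer.Rank1Residual.X1.ParitySqueeze

namespace Summit.BirchSwinnertonDyer.Rank1Residual.X5.O1

variable (W : WeierstrassCurve ℚ) [W.IsElliptic] [W.IsGloballyMinimal]

/-! ## §1 The `λ/μ`-pinch at a NON-SPLIT multiplicative `2` (K11a + `μ = 0` + two finite certificates) -/

/-- **The `λ/μ`-pinch at a non-split multiplicative `2` (PROVED, pure algebra on top of K11a).**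
A cyclotomic dual datum `D` with `X` torsion, `μ(X) = 0`, `λ(X) = n`; the K11a datum for THE `2`-adic
`L`-function `L` (`ι g = 2ᵐ·L`, `g ∈ char X`); `ι L₀ = ϖ·L`; certificates `λ(ϖ·L) = n`, `μ(ϖ·L) = 0`.
Then `char_Λ X = (L₀)`: `L₀ ∈ (f_X)` (`charIdeal_dvd_of_divisibility_of_mu_eq_zero`), `L₀ = f_X·b`, and
equal `μ`, `λ` force `b ∈ Λˣ` (`X1.MuLambda.span_eq_span_iff_mu_lam`). No rank input.
[cite: GreenbergVatsal2000, p. 4 (after Thm. (1.2))] [cite: Kato2004Asterisque, Thm. 17.4 (1)(2) (p. 273) (shape)] -/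
theorem charIdeal_eq_span_of_lambda_mu_pinch_nonsplit
    (hns : ¬ W.HasSplitMultiplicativeReductionAtPrime 2) {n : ℕ}
    (hlan : X2.AnalyticLambdaEq W 2 n) (hμan : X2.AnalyticMuLE W 2 0)
    {κ : ZpExtension ℚ 2} {γ : Field.absoluteGaloisGroup ℚ} (hγ : κ.IsTopGenerator γ)
    {N : ℕ} [NeZero N] {f : CuspForm (Gamma0 N) 2} (hf : IsNewformOf W f) {L : PowerSeries ℚ_[2]}
    (hLf : IsMultPAdicLFunctionOf f 2 (-1) L) (D : W.SelmerDualData κ γ) (hX : D.IsTorsion)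
    (hμ : D.mu = 0) (hlam : D.lambda = n)
    (hdiv : ∃ (m : ℕ) (g : IwasawaAlgebra 2), g ∈ D.charIdeal ∧
      iwasawaToPowerSeries 2 g = PowerSeries.C ((2 : ℚ_[2]) ^ m) * L)
    {ϖ : ℚ} (hϖ : (ϖ : ℝ) * W.realPeriodRat = plusPeriod f) {L₀ : IwasawaAlgebra 2}
    (hL₀ : iwasawaToPowerSeries 2 L₀ = PowerSeries.C (ϖ : ℚ_[2]) * L) :
    D.charIdeal = Ideal.span {L₀} := by
  haveI : Module.Finite (IwasawaAlgebra 2) D.X := D.module_finite_holds hγ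
  obtain ⟨k, hk⟩ := hμan f hf ϖ hϖ L (fun hsp => absurd hsp hns) (fun _ => hLf)
  rw [← hL₀] at hk
  have hμL₀ : mu L₀ = 0 := Nat.le_zero.mp (mu_le_of_lt_norm_coeff hk)
  have hL₀0 : L₀ ≠ 0 := by
    rintro rfl
    rw [map_zero, map_zero, norm_zero] at hk
    exact not_le.mpr hk (by positivity)
  have hL₀mem : L₀ ∈ D.charIdeal :=
    charIdeal_dvd_of_divisibility_of_mu_eq_zero W 2 hγ D hX hμ hdiv hL₀
  haveI : (Module.charIdeal (IwasawaAlgebra 2) D.X).IsPrincipal := charIdeal_isPrincipal_holds 2 D.X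
  obtain ⟨fX, hfX⟩ := Submodule.IsPrincipal.principal (Module.charIdeal (IwasawaAlgebra 2) D.X)
  have hchar : D.charIdeal = Ideal.span {fX} := hfX
  have hfX0 : fX ≠ 0 := by
    intro h0
    refine Module.charIdeal_ne_bot (IwasawaAlgebra 2) D.X ?_
    change D.charIdeal = ⊥
    rw [hchar, h0]
    exact Ideal.span_singleton_eq_bot.mpr rfl
  have hlamfX : lam fX = D.lambda := lam_generator_eq_lambdaInvariant D.X hX hfX0 hchar
  have hlan' : lam L₀ = n := hlan f hf ϖ hϖ L (fun hsp => absurd hsp hns) (fun _ => hLf) L₀ hL₀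
  have hlamEq : lam L₀ = lam fX := by rw [hlan', hlamfX, hlam]
  have hμfX : mu fX = 0 := by
    rw [mu_generator_eq_muInvariant D.X hX hfX0 hchar]; exact hμ
  rw [hchar] at hL₀mem
  obtain ⟨b, hb⟩ := Ideal.mem_span_singleton'.mp hL₀mem
  have hspan : Ideal.span ({L₀} : Set (IwasawaAlgebra 2)) = Ideal.span {fX} :=
    (span_eq_span_iff_mu_lam hfX0 hL₀0 (show L₀ = fX * b by rw [mul_comm, hb])).mpr
      ⟨hμL₀.trans hμfX.symm, hlamEq⟩
  rw [hchar, hspan]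

/-! ## §2 From `char_Λ X = (L₀)` at a non-split `2` to `BSD₂(E)` (BOTH halves) and to the `2`-converse -/

/-- **The EXACT `2`-adic valuation of `L(E,1)/Ω_E` from the main-conjecture equality at a non-split
multiplicative `2` (PROVED).** `W` non-split multiplicative at `2`, `L(E,1) ≠ 0`; A235 as the
hypothesis `hEC`; GZK; a cyclotomic dual datum with `X` torsion and `char_Λ X = (L₀)`, `ι L₀ = ϖ·L`,
`L` THE `2`-adic `L`-function of the newform `f` (`α = −1`, `L(0) = 2·[0]⁺_f`), `ϖ·Ω_E = Ω⁺_f`. Then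
`MissingPPartAt W 2` (`ord₂ #Ш_an = ord₂ #Ш`): `L₀(0)·#E(ℚ)(2)² = u·2^{ord₂∏c+1}·#Sel` (A235 with
`f_E := L₀`), `L₀(0) = ϖ·2·[0]⁺_f`, the two `2`s cancel; Miller's `#Ш_an = (L(E,1)/Ω_E)·#E(ℚ)²/∏c`.
[cite: GreenbergLNM1716, §4 pp. 112–113 (analogue of Thm. 4.1, l_v = 2)]
[cite: MazurTateTeitelbaum1986Invent, §I.14 (L(0) = (1 − α⁻¹)[0]⁺, α = −1)] [cite: Miller2011LMS, Def. 1.1] -/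
theorem missingPPartAt_two_nonsplit_of_charIdeal_eq_span
    (hEC : TwoAdicEulerCharRankZeroNonsplitMult W 0)
    (hGZK : rank_eq_analyticRank_of_analyticRank_le_one)
    (hmult : Mult W 2) (hns : ¬ W.HasSplitMultiplicativeReductionAtPrime 2)
    (hL : W.entireLFunction 1 ≠ 0)
    {κ : ZpExtension ℚ 2} {γ : Field.absoluteGaloisGroup ℚ} {N : ℕ} [NeZero N]
    {f : CuspForm (Gamma0 N) 2} (hκ : κ.IsCyclotomic) (hγ : κ.IsTopGenerator γ)
    (hγ' : IsCyclotomicVariable 2 γ) (hf : IsNewformOf W f) {L : PowerSeries ℚ_[2]}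
    (hLf : IsMultPAdicLFunctionOf f 2 (-1) L) (D : W.SelmerDualData κ γ) (hX : D.IsTorsion)
    {ϖ : ℚ} (hϖ : (ϖ : ℝ) * W.realPeriodRat = plusPeriod f) {L₀ : IwasawaAlgebra 2}
    (hL₀ : iwasawaToPowerSeries 2 L₀ = PowerSeries.C (ϖ : ℚ_[2]) * L)
    (hchar : D.charIdeal = Ideal.span {L₀}) : MissingPPartAt W 2 := by
  have hΩpos : 0 < W.realPeriodRat := W.realPeriodRat_pos_holds
  have hϖ0 : ϖ ≠ 0 := by
    rintro rfl
    have hper : 0 < plusPeriod f := IsNewform0.plusPeriod_pos_holds hf.1 hf.coeffField_eq_bot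
    rw [← hϖ, Rat.cast_zero, zero_mul] at hper
    exact lt_irrefl _ hper
  set s : ℚ := ratPlusSymbol f 0 with hs_def
  set t : ℚ := ϖ * s with ht_def
  have hLval : W.entireLFunction 1 = (((s : ℝ) * plusPeriod f : ℝ) : ℂ) := hf.entireLFunction_one_eq
  have hq : W.entireLFunction 1 / (W.realPeriodRat : ℂ) = ((t : ℚ) : ℂ) := by
    rw [hLval, ← hϖ, div_eq_iff (Complex.ofReal_ne_zero.mpr hΩpos.ne'), ht_def]
    push_cast
    ring
  have hs0 : s ≠ 0 := by
    intro h0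
    apply hL
    rw [hLval, h0]
    simp
  have hvt : padicValRat 2 t = padicValRat 2 ϖ + padicValRat 2 s := by
    rw [ht_def, padicValRat.mul hϖ0 hs0]
  haveI : Module.Finite (IwasawaAlgebra 2) D.X := D.module_finite_holds hγ
  have hsQ0 : (s : ℚ_[2]) ≠ 0 := by exact_mod_cast hs0
  have hϖQ0 : (ϖ : ℚ_[2]) ≠ 0 := by exact_mod_cast hϖ0
  have h20 : (2 : ℚ_[2]) ≠ 0 := two_ne_zero
  have hg0 : ((PowerSeries.constantCoeff L₀ : ℤ_[2]) : ℚ_[2]) = (ϖ : ℚ_[2]) * (2 * (s : ℚ_[2])) := by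
    rw [← constantCoeff_iwasawaToPowerSeries 2 L₀, hL₀, map_mul, PowerSeries.constantCoeff_C,
      hLf.constantCoeff_of_neg_one]
  have hg00 : PowerSeries.constantCoeff L₀ ≠ 0 := by
    intro h0
    rw [h0, PadicInt.coe_zero] at hg0
    exact (mul_ne_zero hϖQ0 (mul_ne_zero h20 hsQ0)) hg0.symm
  have hSelfin : Finite (W.selmerGroupPInfty 2) :=
    D.finite_selmerGroupPInfty_of_constantCoeff_ne_zero W hγ hX L₀ hchar hg00
  obtain ⟨hEfin, hShapfin⟩ := (W.finite_selmerGroupPInfty_iff 2).mp hSelfin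
  haveI := hEfin
  haveI := hShapfin
  haveI := hSelfin
  have hr : W.analyticRank = 0 := analyticRank_eq_zero_of_entireLFunction_one_ne_zero W hL
  obtain ⟨-, hfin⟩ := hGZK W (by rw [hr]; exact zero_le_one)
  haveI : Finite W.sha := hfin
  obtain ⟨u₁, hu₁⟩ := hEC hmult hns κ γ hκ hγ hγ' D hX L₀ hchar hSelfin
  rw [add_zero, zpow_natCast] at hu₁
  haveI : NeZero (2 : ℕ) := ⟨two_ne_zero⟩
  obtain ⟨u₄, hu₄⟩ := exists_unit_torsionOrder_eq W 2
  obtain ⟨u₅, hu₅⟩ := exists_unit_natCard_eq_mul_card_primaryComponent W.sha 2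
  have hSel : Nat.card (W.selmerGroupPInfty 2) = Nat.card (AddCommGroup.primaryComponent W.sha 2) :=
    W.natCard_selmerGroupPInfty_eq_natCard_primaryComponent_sha 2
  set v := padicValNat 2 W.tamagawaProduct with hv
  set Tp : ℚ_[2] := (Nat.card (AddCommGroup.primaryComponent W.toAffine.Point 2) : ℚ_[2]) with hTp
  set Shp : ℚ_[2] := (Nat.card (AddCommGroup.primaryComponent W.sha 2) : ℚ_[2]) with hShp
  have hu₄' : (W.torsionOrder : ℚ_[2]) = ((u₄ : ℤ_[2]) : ℚ_[2]) * Tp := by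
    rw [hu₄, hTp]
    congr 1
    exact_mod_cast natCard_primaryComponent_point_congr W 2 _ _
  have hSha : (W.shaOrder : ℚ_[2]) = ((u₅ : ℤ_[2]) : ℚ_[2]) * Shp := by
    rw [WeierstrassCurve.shaOrder, hShp]
    exact hu₅
  have hSel' : (Nat.card (W.selmerGroupPInfty 2) : ℚ_[2]) = Shp := by rw [hShp, hSel]
  have key : (ϖ : ℚ_[2]) * (2 * (s : ℚ_[2])) * Tp ^ 2 =
      ((u₁ : ℤ_[2]) : ℚ_[2]) * (2 : ℚ_[2]) ^ (v + 1) * Shp := by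
    rw [← hg0, hu₁, hSel']
  have hTp0 : Tp ≠ 0 := by rw [hTp]; exact_mod_cast Nat.card_pos.ne'
  have hShp0 : Shp ≠ 0 := by rw [hShp]; exact_mod_cast Nat.card_pos.ne'
  have hv2 : (2 : ℚ_[2]).valuation = 1 := by
    have h2 : ((2 : ℕ) : ℚ_[2]).valuation = 1 := Padic.valuation_p
    rwa [Nat.cast_ofNat] at h2
  have hvalL : ((ϖ : ℚ_[2]) * (2 * (s : ℚ_[2])) * Tp ^ 2).valuation =
      padicValRat 2 ϖ + (1 + padicValRat 2 s) + 2 * Tp.valuation := by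
    rw [Padic.valuation_mul (mul_ne_zero hϖQ0 (mul_ne_zero h20 hsQ0)) (pow_ne_zero 2 hTp0),
      Padic.valuation_mul hϖQ0 (mul_ne_zero h20 hsQ0), Padic.valuation_mul h20 hsQ0,
      Padic.valuation_pow Tp, hv2, Padic.valuation_ratCast, Padic.valuation_ratCast]
    push_cast
    ring
  have hvalR : (((u₁ : ℤ_[2]) : ℚ_[2]) * (2 : ℚ_[2]) ^ (v + 1) * Shp).valuation =
      ((v : ℤ) + 1) + Shp.valuation := by
    rw [Padic.valuation_mul (mul_ne_zero (coe_units_ne_zero 2 u₁) (pow_ne_zero _ h20)) hShp0,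
      Padic.valuation_mul (coe_units_ne_zero 2 u₁) (pow_ne_zero _ h20), valuation_coe_units_eq_zero,
      Padic.valuation_pow, hv2]
    push_cast
    ring
  have hval := congrArg Padic.valuation key
  rw [hvalL, hvalR] at hval
  have hvT : Tp.valuation = (padicValNat 2 W.torsionOrder : ℤ) := by
    have h := congrArg Padic.valuation hu₄'
    rw [Padic.valuation_natCast, Padic.valuation_mul (coe_units_ne_zero 2 u₄) hTp0,
      valuation_coe_units_eq_zero, zero_add] at h
    exact h.symm
  have hvS : Shp.valuation = (padicValNat 2 W.shaOrder : ℤ) := by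
    have h := congrArg Padic.valuation hSha
    rw [Padic.valuation_natCast, Padic.valuation_mul (coe_units_ne_zero 2 u₅) hShp0,
      valuation_coe_units_eq_zero, zero_add] at h
    exact h.symm
  rw [hvT, hvS] at hval
  obtain ⟨-, hE, -, hshaAn⟩ := shaAn_eq_of_L_one_div_eq hGZK W hL hq
  haveI := hE
  have ht0 : t ≠ 0 := by rw [ht_def]; exact mul_ne_zero hϖ0 hs0
  have hcard : (Nat.card W.toAffine.Point : ℚ) ≠ 0 := by
    exact_mod_cast (Nat.card_pos (α := W.toAffine.Point)).ne'
  have htam : (W.tamagawaProduct : ℚ) ≠ 0 := by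
    exact_mod_cast (W.tamagawaProduct_pos_holds : 0 < W.tamagawaProduct).ne'
  have hcardT : (Nat.card W.toAffine.Point : ℚ) = (W.torsionOrder : ℚ) := by
    exact_mod_cast (W.torsionOrder_eq_natCard_of_finite).symm
  refine ⟨t * (Nat.card W.toAffine.Point : ℚ) ^ 2 / (W.tamagawaProduct : ℚ), hshaAn, ?_⟩
  rw [padicValRat.div (mul_ne_zero ht0 (pow_ne_zero 2 hcard)) htam,
    padicValRat.mul ht0 (pow_ne_zero 2 hcard), padicValRat.pow, hcardT]
  simp only [padicValRat.of_nat, Nat.cast_ofNat]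
  linarith

omit [W.IsGloballyMinimal] in
/-- **The rank-`0` `2`-CONVERSE from the main-conjecture equality at a non-split multiplicative `2`
(PROVED).** Same data; if `Sel_{2^∞}(E/ℚ)` is finite then `L(E,1) ≠ 0` and `r_an(E) = 0`: A235 gives
`L₀(0)·#E(ℚ)(2)² = u·2^{ord₂∏c+1}·#Sel ≠ 0`, `L₀(0) = ϖ·2·[0]⁺_f`, so `L(E,1) = [0]⁺_f·Ω⁺_f ≠ 0`.
[cite: GreenbergLNM1716, §4 pp. 112–113] [cite: MazurTateTeitelbaum1986Invent, §I.14] -/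
theorem entireLFunction_one_ne_zero_of_finite_selmer_of_charIdeal_eq_span_nonsplit
    (hEC : TwoAdicEulerCharRankZeroNonsplitMult W 0)
    (hmult : Mult W 2) (hns : ¬ W.HasSplitMultiplicativeReductionAtPrime 2)
    {κ : ZpExtension ℚ 2} {γ : Field.absoluteGaloisGroup ℚ} {N : ℕ} [NeZero N]
    {f : CuspForm (Gamma0 N) 2} (hκ : κ.IsCyclotomic) (hγ : κ.IsTopGenerator γ)
    (hγ' : IsCyclotomicVariable 2 γ) (hf : IsNewformOf W f) {L : PowerSeries ℚ_[2]}
    (hLf : IsMultPAdicLFunctionOf f 2 (-1) L) (D : W.SelmerDualData κ γ) (hX : D.IsTorsion)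
    {ϖ : ℚ} {L₀ : IwasawaAlgebra 2}
    (hL₀ : iwasawaToPowerSeries 2 L₀ = PowerSeries.C (ϖ : ℚ_[2]) * L)
    (hchar : D.charIdeal = Ideal.span {L₀}) (hfin : Finite (W.selmerGroupPInfty 2)) :
    W.entireLFunction 1 ≠ 0 ∧ W.analyticRank = 0 := by
  haveI : Module.Finite (IwasawaAlgebra 2) D.X := D.module_finite_holds hγ
  haveI := hfin
  obtain ⟨hEfin, hShapfin⟩ := (W.finite_selmerGroupPInfty_iff 2).mp hfin
  haveI := hEfin
  haveI := hShapfin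
  obtain ⟨u₁, hu₁⟩ := hEC hmult hns κ γ hκ hγ hγ' D hX L₀ hchar hfin
  have hR : ((u₁ : ℤ_[2]) : ℚ_[2]) *
      (2 : ℚ_[2]) ^ (((padicValNat 2 W.tamagawaProduct + 1 : ℕ) : ℤ) + 0) *
      (Nat.card (W.selmerGroupPInfty 2) : ℚ_[2]) ≠ 0 := by
    refine mul_ne_zero (mul_ne_zero (coe_units_ne_zero 2 u₁) (zpow_ne_zero _ two_ne_zero)) ?_
    exact_mod_cast Nat.card_pos.ne'
  rw [← hu₁] at hR
  have hL₀0 : ((PowerSeries.constantCoeff L₀ : ℤ_[2]) : ℚ_[2]) ≠ 0 := fun h0 => hR (by rw [h0, zero_mul])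
  have hs : ((PowerSeries.constantCoeff L₀ : ℤ_[2]) : ℚ_[2]) =
      (ϖ : ℚ_[2]) * (2 * ((ratPlusSymbol f 0 : ℚ) : ℚ_[2])) := by
    rw [← constantCoeff_iwasawaToPowerSeries 2 L₀, hL₀, map_mul, PowerSeries.constantCoeff_C,
      hLf.constantCoeff_of_neg_one]
  have hs0 : ratPlusSymbol f 0 ≠ 0 := by
    intro h0
    apply hL₀0
    rw [hs, h0]
    simp
  have hL : W.entireLFunction 1 ≠ 0 := by
    rw [hf.entireLFunction_one_eq]
    have hper : 0 < plusPeriod f := IsNewform0.plusPeriod_pos_holds hf.1 hf.coeffField_eq_bot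
    exact_mod_cast mul_ne_zero (Rat.cast_ne_zero.mpr hs0) hper.ne'
  exact ⟨hL, analyticRank_eq_zero_of_entireLFunction_one_ne_zero W hL⟩

/-! ## §3 The ANCHOR: `λ(X(E₀/ℚ_∞)) = 0` from K11a / K11b-Rat and two finite certificates -/

/-- **`λ(X) = 0` from a non-zero `G ∈ char_Λ X = (f_X)` with `λ(G) = 0`**: `λ(X) = λ(f_X) ≤ λ(G)`. [folklore] -/
theorem lambda_eq_zero_of_mem_of_lam_eq_zero (A : WeierstrassCurve ℚ) [A.IsElliptic]
    [A.IsGloballyMinimal] {κ : ZpExtension ℚ 2} {γ : Field.absoluteGaloisGroup ℚ}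
    (hγ : κ.IsTopGenerator γ) (DA : A.SelmerDualData κ γ) (hX : DA.IsTorsion) {G : IwasawaAlgebra 2}
    (hmem : G ∈ DA.charIdeal) (hG0 : G ≠ 0) (hlam : lam G = 0) : DA.lambda = 0 := by
  haveI : Module.Finite (IwasawaAlgebra 2) DA.X := DA.module_finite_holds hγ
  haveI : (Module.charIdeal (IwasawaAlgebra 2) DA.X).IsPrincipal := charIdeal_isPrincipal_holds 2 DA.X
  obtain ⟨fX, hfX⟩ := Submodule.IsPrincipal.principal (Module.charIdeal (IwasawaAlgebra 2) DA.X)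
  have hchar : DA.charIdeal = Ideal.span {fX} := hfX
  have hfX0 : fX ≠ 0 := by
    intro h0
    refine Module.charIdeal_ne_bot (IwasawaAlgebra 2) DA.X ?_
    change DA.charIdeal = ⊥
    rw [hchar, h0]
    exact Ideal.span_singleton_eq_bot.mpr rfl
  rw [hchar] at hmem
  obtain ⟨b, hb⟩ := Ideal.mem_span_singleton'.mp hmem
  have hb0 : b ≠ 0 := by
    rintro rfl
    exact hG0 (by rw [← hb, zero_mul])
  have hle : lam fX ≤ lam G := by
    rw [← hb, lam_mul hb0 hfX0]
    exact Nat.le_add_left _ _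
  rw [hlam] at hle
  have hlamfX : lam fX = DA.lambda := lam_generator_eq_lambdaInvariant DA.X hX hfX0 hchar
  rw [← hlamfX]
  exact Nat.le_zero.mp hle

/-- **Anchor, NON-SPLIT at `2` (PROVED):** `A` non-split multiplicative at `2`; a cyclotomic dual datum
`DA` with `μ = 0`; K11a at `A` (`hK`); Néron integrality `hper₀` (INT2-AUTO-ns: `ι L₀ = ϖ₀·L`); the
certificates `λ(ϖ₀·L₂(E₀)) = 0` (`X2.AnalyticLambdaEq A 2 0`) and `μ_an ≤ m₀` for SOME `m₀`
(`X2.AnalyticMuLE A 2 m₀`: one non-zero coefficient). Then `X(E₀/ℚ_∞)` is torsion with `λ = 0`: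
`L₀ ∈ (f_{X₀})` (the any-`L` `μ = 0` upgrade), so `λ(f_{X₀}) ≤ λ(L₀) = 0`. No `BSD₂(E₀)`, no rank input.
[cite: GreenbergVatsal2000, p. 4] [cite: MazurTateTeitelbaum1986Invent, §I.12 and §I.14] -/
theorem anchor_lambda_eq_zero_nonsplit (A : WeierstrassCurve ℚ) [A.IsElliptic] [A.IsGloballyMinimal]
    (hmultA : Mult A 2) (hnsA : ¬ A.HasSplitMultiplicativeReductionAtPrime 2)
    (hK : ∀ [NeZero (A.conductorNorm ℤ)] (f : CuspForm (Gamma0 (A.conductorNorm ℤ)) 2)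
      (L : PowerSeries ℚ_[2]), KatoDivisibilityAtTwoNonsplitMultRat A f L)
    (hper₀ : ∀ [NeZero (A.conductorNorm ℤ)] (f : CuspForm (Gamma0 (A.conductorNorm ℤ)) 2),
      IsNewformOf A f → ∀ ϖ : ℚ, (ϖ : ℝ) * A.realPeriodRat = plusPeriod f → 0 ≤ padicValRat 2 ϖ)
    (hlan : X2.AnalyticLambdaEq A 2 0) {m₀ : ℕ} (hμan : X2.AnalyticMuLE A 2 m₀)
    (hmod : nonempty_modularParametrizationData)
    {κ : ZpExtension ℚ 2} {γ : Field.absoluteGaloisGroup ℚ} (hκ : κ.IsCyclotomic)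
    (hγ : κ.IsTopGenerator γ) (hγ' : IsCyclotomicVariable 2 γ) (DA : A.SelmerDualData κ γ)
    (hμ : DA.mu = 0) : DA.IsTorsion ∧ DA.lambda = 0 := by
  haveI : NeZero (A.conductorNorm ℤ) := ⟨(A.conductorNorm_pos_holds).ne'⟩
  haveI : Module.Finite (IwasawaAlgebra 2) DA.X := DA.module_finite_holds hγ
  obtain ⟨Dm⟩ := hmod A
  have hf : IsNewformOf A Dm.f := Dm.isNewformOf
  obtain ⟨ϖ, -, hϖ, -⟩ := Dm.exists_rat_mul_realPeriodRat_eq_plusPeriod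
  obtain ⟨L, hLf⟩ := exists_isMultPAdicLFunctionOf_neg_one_of_nonsplit hf hmultA hnsA
  obtain ⟨hX, m, g, hg, hι⟩ := hK Dm.f L κ γ hκ hγ hγ' hmultA hnsA hf hLf DA
  obtain ⟨L₀, hL₀⟩ := exists_iwasawaToPowerSeries_eq_C_mul_of_isMultPAdicLFunctionOf_neg_one_two hf
    hmultA hnsA (hper₀ Dm.f hf ϖ hϖ) hLf
  have hmem : L₀ ∈ DA.charIdeal :=
    charIdeal_dvd_of_divisibility_of_mu_eq_zero A 2 hγ DA hX hμ ⟨m, g, hg, hι⟩ hL₀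
  have hlan' : lam L₀ = 0 :=
    hlan Dm.f hf ϖ hϖ L (fun hsp => absurd hsp hnsA) (fun _ => hLf) L₀ hL₀
  obtain ⟨k, hk⟩ := hμan Dm.f hf ϖ hϖ L (fun hsp => absurd hsp hnsA) (fun _ => hLf)
  rw [← hL₀] at hk
  have hL₀0 : L₀ ≠ 0 := by
    rintro rfl
    rw [map_zero, map_zero, norm_zero] at hk
    exact not_le.mpr hk (by positivity)
  refine ⟨hX, lambda_eq_zero_of_mem_of_lam_eq_zero A hγ DA hX hmem hL₀0 hlan'⟩

/-- **Anchor, SPLIT at `2` (PROVED):** `A` split multiplicative at `2`; `μ(X(E₀/ℚ_∞)) = 0`; K11b-Rat at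
`A` (`hK`); `hper₀` (INT2-AUTO-sp); certificates `λ(ϖ₀·L₂(E₀)) = 1` (`X2.AnalyticLambdaEq A 2 1`:
ONLY the trivial zero) and `X2.AnalyticMuLE A 2 m₀`. Then `X(E₀/ℚ_∞)` is torsion with `λ = 0`: the
deflated `μ = 0` upgrade gives `L₁ ∈ (f_{X₀})`, `L₀ = T·L₁`, `λ(L₁) = λ(L₀) − 1 = 0 ≥ λ(f_{X₀})`.
[cite: GreenbergVatsal2000, p. 4] [cite: MazurTateTeitelbaum1986Invent, §I.12 and §I.15] -/
theorem anchor_lambda_eq_zero_split (A : WeierstrassCurve ℚ) [A.IsElliptic] [A.IsGloballyMinimal]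
    (hmultA : Mult A 2) (hspA : A.HasSplitMultiplicativeReductionAtPrime 2)
    (hK : ∀ [NeZero (A.conductorNorm ℤ)] (f : CuspForm (Gamma0 (A.conductorNorm ℤ)) 2)
      (L : PowerSeries ℚ_[2]), KatoDivisibilityAtTwoSplitMultRat A f L)
    (hper₀ : ∀ [NeZero (A.conductorNorm ℤ)] (f : CuspForm (Gamma0 (A.conductorNorm ℤ)) 2),
      IsNewformOf A f → ∀ ϖ : ℚ, (ϖ : ℝ) * A.realPeriodRat = plusPeriod f → 0 ≤ padicValRat 2 ϖ)
    (hlan : X2.AnalyticLambdaEq A 2 1) {m₀ : ℕ} (hμan : X2.AnalyticMuLE A 2 m₀)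
    (hmod : nonempty_modularParametrizationData)
    {κ : ZpExtension ℚ 2} {γ : Field.absoluteGaloisGroup ℚ} (hκ : κ.IsCyclotomic)
    (hγ : κ.IsTopGenerator γ) (hγ' : IsCyclotomicVariable 2 γ) (DA : A.SelmerDualData κ γ)
    (hμ : DA.mu = 0) : DA.IsTorsion ∧ DA.lambda = 0 := by
  haveI : NeZero (A.conductorNorm ℤ) := ⟨(A.conductorNorm_pos_holds).ne'⟩
  haveI : Module.Finite (IwasawaAlgebra 2) DA.X := DA.module_finite_holds hγ
  obtain ⟨Dm⟩ := hmod A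
  have hf : IsNewformOf A Dm.f := Dm.isNewformOf
  obtain ⟨ϖ, -, hϖ, -⟩ := Dm.exists_rat_mul_realPeriodRat_eq_plusPeriod
  obtain ⟨L, hLf⟩ := exists_isSplitMultPAdicLFunctionOf hspA hf
  obtain ⟨hX, m, g, hg, hι⟩ := hK Dm.f L κ γ hκ hγ hγ' hmultA hspA hf hLf DA
  obtain ⟨L₀, hL₀⟩ := exists_integral_mul_of_isSplitMultPAdicLFunctionOf_two_of_padicValRat_nonneg A
    hspA hf hLf (hper₀ Dm.f hf ϖ hϖ)
  obtain ⟨L₁, hmem, hιL₁⟩ := exists_mem_charIdeal_X_mul_of_mu_eq_zero A hγ DA hX hμ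
    hLf.constantCoeff_eq_zero ⟨m, g, hg, hι⟩ hL₀
  have hL₀eq : L₀ = PowerSeries.X * L₁ :=
    iwasawaToPowerSeries_injective 2 (by rw [hL₀, hιL₁])
  have hlan' : lam L₀ = 1 :=
    hlan Dm.f hf ϖ hϖ L (fun _ => hLf) (fun hns => absurd hspA hns) L₀ hL₀
  obtain ⟨k, hk⟩ := hμan Dm.f hf ϖ hϖ L (fun _ => hLf) (fun hns => absurd hspA hns)
  rw [← hL₀] at hk
  have hL₀0 : L₀ ≠ 0 := by
    rintro rfl
    rw [map_zero, map_zero, norm_zero] at hk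
    exact not_le.mpr hk (by positivity)
  have hL₁0 : L₁ ≠ 0 := by
    rintro rfl
    exact hL₀0 (by rw [hL₀eq, mul_zero])
  have hlamL₁ : lam L₁ = 0 := by
    rw [hL₀eq, lam_mul PowerSeries.X_ne_zero hL₁0, X2.lam_X] at hlan'
    omega
  exact ⟨hX, lambda_eq_zero_of_mem_of_lam_eq_zero A hγ DA hX hmem hL₁0 hlamL₁⟩

end Summit.BirchSwinnertonDyer.Rank1Residual.X5.O1

end
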